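import Mathlib
import HarnessLib
import Literature.Probability.MarkovChains.MetropolizedGibbs

/-!
# Random-link heat bath versus METROPOLIZED heat bath for discrete link variables: the Metropolized
# update is exact, needs only local weight ratios, and never has larger integrated autocorrelation

HONEST FRAMING: exact (Metropolis-corrected) sampling algorithms for lattice gauge theory; figures
of merit are autocorrelation/cost numbers at stated couplings and volumes; no continuum-physics claim.

Venture `LatticeQCDFlow` (cell pub-lqcd), topic `Scoring`; row 33 (`lit-codes`, literature-prover
seat GEN-42).  NEW WORK of the cell = the lattice SPECIALISATION of `MetropolizedGibbs.lean` (Liu 2001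
Thm 13.3.3): `n` link variables (`Fin n`, `n ≥ 1`) with values in a finite set `G` (a discrete gauge
group `Z_N`, a `q`-state Potts spin, …), an arbitrary positive Boltzmann weight
`w : (Fin n → G) → ℝ` — NOT normalised: the partition function `Z = Σ_V w V` never has to be known —
the Gibbs law `p = w/Z`, and uniform random link selection.  Nothing is cited as a fact and no
definition is introduced; the kernels are the Literature ones
(`randomScanGibbs (fun _ => 1/n) p` = random-link HEAT BATH, `randomScanMGibbs (fun _ => 1/n) p` =
random-link METROPOLIZED HEAT BATH: propose a new link value `g ≠ U_ℓ` with probability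
`∝ w(U with U_ℓ ← g)`, accept with `min{1, (1 − p(U_ℓ | rest))/(1 − p(g | rest))}`).

* `boltzmann_fullConditional` — the full conditional of link `ℓ` is the LOCAL heat-bath law
  `p(g | rest) = w(U with U_ℓ ← g)/Σ_h w(U with U_ℓ ← h)`: `Z` cancels, only the weights of the `|G|`
  local modifications of `U` enter (for a Wilson-type action, only the plaquettes containing `ℓ`);
* `heatBath_detailedBalance`, `metropolizedHeatBath_detailedBalance` — both updates are exact for `p`;
* **`asympVar_metropolizedHeatBath_le`** — for EVERY observable `f`,
  `v(f, p, P_MHB) ≤ v(f, p, P_HB)`: at one link update per step the Metropolized heat bath never has a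
  larger asymptotic variance (= `2 τ_int · var`) than the heat bath — unconditionally (irreducibility
  is proved, not assumed); **`spectralGapR_heatBath_le`** — nor a smaller right spectral gap;
* `metropolizedHeatBath_Z2` — for `G = Bool` (a `Z₂` link) the Metropolized heat bath IS the
  single-link Metropolis flip: it moves `U → U^{(ℓ)}` (link `ℓ` flipped) with probability
  `(1/n) · min{1, w(U^{(ℓ)})/w(U)}`.

NOT CLAIMED: strict improvement; continuous groups (`U(1)`, `SU(N)`: the theorem is about finite
`G`); systematic (sweep-ordered) scans; any cost statement (the Metropolized update draws from the
same local law minus one state — same cost class — but wall-clock is for the LEADERBOARD, not for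
this file); anything about a specific action or any number of ours.
-/

namespace Summit.Ventures.LatticeQCDFlow.Scoring

open Finset Function Literature.Probability.MarkovChains

variable {n : ℕ} {G : Type*} [Fintype G] [DecidableEq G] {w : (Fin n → G) → ℝ}

omit [DecidableEq G] in
/-- The Gibbs law is a positive probability vector. -/
private theorem gibbs_pos (hw : ∀ U, 0 < w U) (U : Fin n → G) : 0 < w U / ∑ V, w V :=
  div_pos (hw U) (sum_pos (fun V _ => hw V) ⟨U, mem_univ _⟩)

omit [DecidableEq G] in
/-- … summing to one. -/
private theorem gibbs_sum [Nonempty G] (hw : ∀ U, 0 < w U) : ∑ U, w U / ∑ V, w V = 1 := by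
  rw [← sum_div]
  exact div_self (sum_pos (fun V _ => hw V) univ_nonempty).ne'

/-- Uniform link selection is a probability vector. -/
private theorem uniform_sum [NeZero n] : ∑ _ℓ : Fin n, (n : ℝ)⁻¹ = 1 := by
  rw [sum_const, card_univ, Fintype.card_fin, nsmul_eq_mul]
  exact mul_inv_cancel₀ (Nat.cast_ne_zero.mpr (NeZero.ne n))

omit [DecidableEq G] in
/-- **The full conditional of one link is the LOCAL heat-bath law**: with `p = w/Z`,
`p(g | U_{[-ℓ]}) = w(U with U_ℓ ← g) / Σ_h w(U with U_ℓ ← h)` — the partition function cancels. -/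
theorem boltzmann_fullConditional (hw : ∀ U, 0 < w U) (ℓ : Fin n) (U : Fin n → G) (g : G) :
    fullConditional (fun U => w U / ∑ V, w V) ℓ U g
      = w (update U ℓ g) / ∑ h, w (update U ℓ h) := by
  unfold fullConditional
  have hZ : (∑ V, w V) ≠ 0 := (sum_pos (fun V _ => hw V) ⟨U, mem_univ _⟩).ne'
  rw [← sum_div, div_div_div_cancel_right₀ hZ]

/-- The random-link heat bath is exact (`p`-reversible). -/
theorem heatBath_detailedBalance (w : (Fin n → G) → ℝ) :
    DetailedBalance (fun U => w U / ∑ V, w V)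
      (randomScanGibbs (fun _ : Fin n => (n : ℝ)⁻¹) (fun U => w U / ∑ V, w V)) :=
  randomScanGibbs_detailedBalance _ _

/-- The random-link Metropolized heat bath is exact (`p`-reversible). -/
theorem metropolizedHeatBath_detailedBalance (hw : ∀ U, 0 < w U) :
    DetailedBalance (fun U => w U / ∑ V, w V)
      (randomScanMGibbs (fun _ : Fin n => (n : ℝ)⁻¹) (fun U => w U / ∑ V, w V)) :=
  randomScanMGibbs_detailedBalance (gibbs_pos hw) _

/-- **METROPOLIZED HEAT BATH ≽ HEAT BATH for discrete links**: for every positive Boltzmann weight on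
`n ≥ 1` links with values in a finite `G` and every observable `f`,
`v(f, p, P_MHB) ≤ v(f, p, P_HB)` (uniform random link choice; Liu 2001 Thm 13.3.3 with the
irreducibility of the heat bath discharged). -/
theorem asympVar_metropolizedHeatBath_le [NeZero n] [Nonempty G] (hw : ∀ U, 0 < w U)
    (f : (Fin n → G) → ℝ) :
    asympVar f (fun U => w U / ∑ V, w V)
        (randomScanMGibbs (fun _ : Fin n => (n : ℝ)⁻¹) (fun U => w U / ∑ V, w V))
      ≤ asympVar f (fun U => w U / ∑ V, w V)
        (randomScanGibbs (fun _ : Fin n => (n : ℝ)⁻¹) (fun U => w U / ∑ V, w V)) :=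
  Liu2001_thm_13_3_3 (fun _ => inv_pos.mpr (Nat.cast_pos.mpr (Nat.pos_of_ne_zero (NeZero.ne n))))
    uniform_sum (gibbs_pos hw) (gibbs_sum hw) f

/-- … and `Gap_R(P_HB) ≤ Gap_R(P_MHB)`. -/
theorem spectralGapR_heatBath_le [NeZero n] (hw : ∀ U, 0 < w U) :
    spectralGapR (fun U => w U / ∑ V, w V)
        (randomScanGibbs (fun _ : Fin n => (n : ℝ)⁻¹) (fun U => w U / ∑ V, w V))
      ≤ spectralGapR (fun U => w U / ∑ V, w V)
        (randomScanMGibbs (fun _ : Fin n => (n : ℝ)⁻¹) (fun U => w U / ∑ V, w V)) :=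
  Liu2001_thm_13_3_3_spectralGapR (fun _ => inv_nonneg.mpr (Nat.cast_nonneg n)) uniform_sum
    (gibbs_pos hw)

/-- **`Z₂` links: the Metropolized heat bath is the single-link METROPOLIS flip.**  For `G = Bool`
the move `U → U with U_ℓ ← ¬U_ℓ` has probability `(1/n) · min{1, w(U with U_ℓ flipped)/w(U)}`. -/
theorem metropolizedHeatBath_Z2 {w : (Fin n → Bool) → ℝ} (hw : ∀ U, 0 < w U) (U : Fin n → Bool)
    (ℓ : Fin n) :
    randomScanMGibbs (fun _ : Fin n => (n : ℝ)⁻¹) (fun U => w U / ∑ V, w V) U (update U ℓ (!U ℓ))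
      = (n : ℝ)⁻¹ * min 1 (w (update U ℓ (!U ℓ)) / w U) := by
  have hflip : (!U ℓ) ≠ U ℓ := by cases U ℓ <;> decide
  unfold randomScanMGibbs
  rw [siteScan_apply_update _ _ U ℓ hflip]
  have hc := fullConditional_pos (gibbs_pos hw) ℓ U
  -- the two conditionals sum to one
  have h2 : fullConditional (fun U => w U / ∑ V, w V) ℓ U (U ℓ)
      + fullConditional (fun U => w U / ∑ V, w V) ℓ U (!U ℓ) = 1 := by
    have hs := fullConditional_sum (gibbs_pos hw) ℓ U
    rw [Fintype.sum_bool] at hs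
    cases U ℓ
    · simpa [add_comm] using hs
    · simpa using hs
  rw [mgibbsKernel_of_two hc (Ne.symm hflip) h2, boltzmann_fullConditional hw,
    boltzmann_fullConditional hw, update_eq_self, div_div_div_cancel_right₀
      (sum_pos (fun h _ => hw _) ⟨U ℓ, mem_univ _⟩).ne']

end Summit.Ventures.LatticeQCDFlow.Scoring
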